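import Summits.QuantumFields.YangMills.Theorems.LuscherReductionOneSiteLevelsKacFourier
import Summits.QuantumFields.YangMills.Theorems.LuscherReductionOneSiteLevelsKacHeatFlow

/-!
# INNER, flat lane (layer III): the eigen-span `F = Σ c_j f_j` — decay, derivatives, `H₀F`

Support module of crux `OneSiteLevels` (route `LuscherReduction`, item stmt-QuantumFields-20007), FLAT lane of the
registered v12 stub `stub_flatKacAL1` (STUB-PLAN rev 3 row III.8, bookkeeping half).

For an AL1 eigenfamily `f_0, …, f_m` (`IsEigenFamily m f`) and coefficients `c`, the span `eigSpan f c = Σ c_j f_j` and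
`eigSpanH0 f c = H₀F = −½ΔF`:
* uniform `ExpDecay₂` constants for the family; pointwise bounds `|F|, |∂F|, |∂²F| ≤ C e^{−‖x‖}`, `‖DF‖, ‖D∂_pF‖ ≤ 3C e^{−‖x‖}`;
  integrability of `F, ∂F, ∂²F`, their squares, and of `‖DF‖`, `‖D∂_pF‖`;
* `H₀F = Σ c_j (E_j − V) f_j` pointwise (eigen-equation), `H₀F ∈ L¹ ∩ L²`, and `∫ (H₀F)² ≤ K · Σ c_j²` with
  `K = Σ_j ∫ ((E_j − V) f_j)²` (Cauchy–Schwarz in `j`).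

Real analysis only ([folklore]); NOT the stub; femto rung R2b1; NOT a claim about the gap.
-/

set_option autoImplicit false

noncomputable section

open MeasureTheory Filter Topology Real
open Literature.Analysis.OperatorTheory.YMMatrixModel

namespace Summit.QuantumFields.YangMills.Theorems.FemtoTransferGap

section Span

variable {m : ℕ} {f : Fin (m + 1) → ZM → ℝ}

/-- The eigen-span `F = Σ_j c_j f_j`. [folklore] -/
def eigSpan (f : Fin (m + 1) → ZM → ℝ) (c : Fin (m + 1) → ℝ) : ZM → ℝ := fun x => ∑ j, c j * f j x

/-- `H₀F = −½ ΔF` for the eigen-span. [folklore] -/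
def eigSpanH0 (f : Fin (m + 1) → ZM → ℝ) (c : Fin (m + 1) → ℝ) : ZM → ℝ := fun x => -(1 / 2 : ℝ) * laplacian (eigSpan f c) x

/-- `eigSpan` unfolded. [folklore] -/
theorem eigSpan_apply (f : Fin (m + 1) → ZM → ℝ) (c : Fin (m + 1) → ℝ) (x : ZM) : eigSpan f c x = ∑ j, c j * f j x := rfl

/-- `eigSpan` as the `fun`-span used elsewhere. [folklore] -/
theorem eigSpan_eq (f : Fin (m + 1) → ZM → ℝ) (c : Fin (m + 1) → ℝ) : eigSpan f c = fun x => ∑ j, c j * f j x := rfl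

/-- `eigSpanH0` unfolded. [folklore] -/
theorem eigSpanH0_apply (f : Fin (m + 1) → ZM → ℝ) (c : Fin (m + 1) → ℝ) (x : ZM) :
    eigSpanH0 f c x = -(1 / 2 : ℝ) * laplacian (eigSpan f c) x := rfl

/-- **Uniform decay constants** for an `ExpDecay₂` family: one `C ≥ 0` for all `f_j` and their partials up to order two.
[cite: Agmon1982, Cor. 4.5] -/
theorem exists_uniform_expDecay₂ (hdec : ∀ j, ExpDecay₂ (f j)) :
    ∃ C : ℝ, 0 ≤ C ∧ ∀ j x, |f j x| ≤ C * Real.exp (-‖x‖) ∧ (∀ p, |pderiv p (f j) x| ≤ C * Real.exp (-‖x‖)) ∧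
      ∀ p q, |pderiv p (pderiv q (f j)) x| ≤ C * Real.exp (-‖x‖) := by
  choose C hC0 hC using fun j => (hdec j).exists_nonneg
  have hle : ∀ j (x : ZM), C j * Real.exp (-‖x‖) ≤ (∑ i, C i) * Real.exp (-‖x‖) := fun j x =>
    mul_le_mul_of_nonneg_right (Finset.single_le_sum (fun i _ => hC0 i) (Finset.mem_univ j)) (Real.exp_pos _).le
  exact ⟨∑ i, C i, Finset.sum_nonneg fun i _ => hC0 i, fun j x =>
    ⟨((hC j x).1).trans (hle j x), fun p => ((hC j x).2.1 p).trans (hle j x), fun p q => ((hC j x).2.2 p q).trans (hle j x)⟩⟩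

/-- `|Σ c_j g_j(x)| ≤ (Σ|c_j|) C e^{−‖x‖}` when `|g_j(x)| ≤ C e^{−‖x‖}`. [folklore] -/
theorem abs_sum_mul_le_of_le {g : Fin (m + 1) → ZM → ℝ} {C : ℝ} (x : ZM) (hg : ∀ j, |g j x| ≤ C * Real.exp (-‖x‖))
    (c : Fin (m + 1) → ℝ) : |∑ j, c j * g j x| ≤ (∑ j, |c j|) * (C * Real.exp (-‖x‖)) := by
  rw [Finset.sum_mul]
  refine (Finset.abs_sum_le_sum_abs _ _).trans (Finset.sum_le_sum fun j _ => ?_)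
  rw [abs_mul]
  exact mul_le_mul_of_nonneg_left (hg j) (abs_nonneg _)

/-- A continuous function dominated by `A e^{−‖x‖}` is integrable. [folklore] -/
theorem integrable_of_le_exp {g : ZM → ℝ} (hg : Continuous g) {A : ℝ} (h : ∀ x, |g x| ≤ A * Real.exp (-‖x‖)) :
    Integrable g :=
  (integrable_exp_neg_norm.const_mul A).mono' hg.aestronglyMeasurable
    (Eventually.of_forall fun x => by rw [Real.norm_eq_abs]; exact h x)

/-- … and square-integrable. [folklore] -/
theorem integrable_sq_of_le_exp {g : ZM → ℝ} (hg : Continuous g) {A : ℝ} (h : ∀ x, |g x| ≤ A * Real.exp (-‖x‖)) :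
    Integrable fun x => g x ^ 2 := by
  have hA : 0 ≤ A := by
    have := (abs_nonneg _).trans (h 0); rw [norm_zero, neg_zero, Real.exp_zero, mul_one] at this; exact this
  refine (integrable_exp_neg_norm.const_mul (A ^ 2)).mono' (hg.fun_pow 2).aestronglyMeasurable
    (Eventually.of_forall fun x => ?_)
  rw [Real.norm_eq_abs, abs_of_nonneg (sq_nonneg _)]
  have h1 : g x ^ 2 ≤ (A * Real.exp (-‖x‖)) ^ 2 := by rw [← sq_abs]; exact pow_le_pow_left₀ (abs_nonneg _) (h x) 2
  have he : Real.exp (-‖x‖) ≤ 1 := Real.exp_le_one_iff.mpr (neg_nonpos.mpr (norm_nonneg x))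
  have he0 := Real.exp_pos (-‖x‖)
  nlinarith [mul_le_mul_of_nonneg_left he (mul_nonneg (sq_nonneg A) he0.le)]

/-- `‖Du(x)‖ ≤ 3B` when all partials are `≤ B` in absolute value (nine coordinates). [folklore] -/
theorem norm_fderiv_le_of_pderiv_le {u : ZM → ℝ} {x : ZM} {B : ℝ} (hB : 0 ≤ B) (h : ∀ p, |pderiv p u x| ≤ B) :
    ‖fderiv ℝ u x‖ ≤ 3 * B := by
  rw [← norm_gradient_eq_norm_fderiv]
  have hsq : ‖gradient u x‖ ^ 2 ≤ (3 * B) ^ 2 := by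
    rw [norm_gradient_sq]
    calc ∑ p, pderiv p u x ^ 2 ≤ ∑ _p : Fin 3 × Fin 3, B ^ 2 := Finset.sum_le_sum fun p _ => by
            rw [← sq_abs]; exact pow_le_pow_left₀ (abs_nonneg _) (h p) 2
      _ = (3 * B) ^ 2 := by simp; ring
  nlinarith [norm_nonneg (gradient u x)]

variable (hf : IsEigenFamily m f)
include hf

/-- The span is `C^n` for every `n`. [folklore] -/
theorem eigSpan_contDiff (c : Fin (m + 1) → ℝ) (n : ℕ∞) : ContDiff ℝ n (eigSpan f c) :=
  contDiff_sum_mul (fun j => hf.1 j n) c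

/-- **Pointwise decay of the span and its partials up to order two.** [cite: Agmon1982, Cor. 4.5] -/
theorem eigSpan_decay (c : Fin (m + 1) → ℝ) :
    ∃ C : ℝ, 0 ≤ C ∧ ∀ x, |eigSpan f c x| ≤ C * Real.exp (-‖x‖) ∧ (∀ p, |pderiv p (eigSpan f c) x| ≤ C * Real.exp (-‖x‖)) ∧
      ∀ p q, |pderiv p (pderiv q (eigSpan f c)) x| ≤ C * Real.exp (-‖x‖) := by
  obtain ⟨C, hC0, hC⟩ := exists_uniform_expDecay₂ hf.2.2.2.2
  have h2 : ∀ j, ContDiff ℝ 2 (f j) := fun j => hf.1 j 2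
  have hd : ∀ j, Differentiable ℝ (f j) := fun j => differentiable_of_contDiff_two (h2 j)
  refine ⟨(∑ j, |c j|) * C, by positivity, fun x => ⟨?_, fun p => ?_, fun p q => ?_⟩⟩
  · rw [eigSpan_apply, mul_assoc]; exact abs_sum_mul_le_of_le x (fun j => (hC j x).1) c
  · rw [eigSpan_eq, pderiv_sum_mul hd c p x, mul_assoc]; exact abs_sum_mul_le_of_le x (fun j => (hC j x).2.1 p) c
  · rw [eigSpan_eq, pderiv_pderiv_sum_mul h2 c p q x, mul_assoc]; exact abs_sum_mul_le_of_le x (fun j => (hC j x).2.2 p q) c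

/-- **Integrability package of the span**: `F, ∂_pF, ∂_p∂_qF ∈ L¹`, their squares in `L¹`, and `‖DF‖, ‖D(∂_pF)‖ ∈ L¹`. [folklore] -/
theorem eigSpan_integrable (c : Fin (m + 1) → ℝ) :
    Integrable (eigSpan f c) ∧ (∀ p, Integrable (pderiv p (eigSpan f c))) ∧
      (∀ p q, Integrable (pderiv p (pderiv q (eigSpan f c)))) ∧ Integrable (fun x => eigSpan f c x ^ 2) ∧
      (∀ p, Integrable fun x => pderiv p (eigSpan f c) x ^ 2) ∧
      Integrable (fun x => ‖fderiv ℝ (eigSpan f c) x‖) ∧ ∀ p, Integrable (fun x => ‖fderiv ℝ (pderiv p (eigSpan f c)) x‖) := by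
  obtain ⟨C, hC0, hC⟩ := eigSpan_decay hf c
  have h2 : ContDiff ℝ 2 (eigSpan f c) := eigSpan_contDiff hf c 2
  have hc0 : Continuous (eigSpan f c) := h2.continuous
  have hc1 : ∀ p, Continuous (pderiv p (eigSpan f c)) := continuous_pderiv_of_contDiff_two h2
  have hc2 : ∀ p q, Continuous (pderiv p (pderiv q (eigSpan f c))) := continuous_pderiv_pderiv_of_contDiff_two h2
  have hD0 : ∀ x, ‖fderiv ℝ (eigSpan f c) x‖ ≤ 3 * (C * Real.exp (-‖x‖)) := fun x =>
    norm_fderiv_le_of_pderiv_le (by positivity) (fun p => (hC x).2.1 p)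
  have hD1 : ∀ p x, ‖fderiv ℝ (pderiv p (eigSpan f c)) x‖ ≤ 3 * (C * Real.exp (-‖x‖)) := fun p x =>
    norm_fderiv_le_of_pderiv_le (by positivity) (fun q => (hC x).2.2 q p)
  have hcD0 : Continuous fun x => ‖fderiv ℝ (eigSpan f c) x‖ := (h2.continuous_fderiv two_ne_zero).norm
  have hcD1 : ∀ p, Continuous fun x => ‖fderiv ℝ (pderiv p (eigSpan f c)) x‖ := fun p =>
    ((contDiff_one_pderiv h2 p).continuous_fderiv one_ne_zero).norm
  refine ⟨integrable_of_le_exp hc0 (fun x => (hC x).1), fun p => integrable_of_le_exp (hc1 p) (fun x => (hC x).2.1 p),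
    fun p q => integrable_of_le_exp (hc2 p q) (fun x => (hC x).2.2 p q), integrable_sq_of_le_exp hc0 (fun x => (hC x).1),
    fun p => integrable_sq_of_le_exp (hc1 p) (fun x => (hC x).2.1 p), ?_, fun p => ?_⟩
  · refine integrable_of_le_exp hcD0 (A := 3 * C) (fun x => ?_)
    rw [abs_of_nonneg (norm_nonneg _)]; linarith [hD0 x]
  · refine integrable_of_le_exp (hcD1 p) (A := 3 * C) (fun x => ?_)
    rw [abs_of_nonneg (norm_nonneg _)]; linarith [hD1 p x]

/-- **The eigen-equation for the span**: `H₀F = Σ c_j (E_j − V) f_j` pointwise. [cite: ReedSimonIV1978, Thm. XIII.64] -/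
theorem eigSpanH0_eq (c : Fin (m + 1) → ℝ) (x : ZM) :
    eigSpanH0 f c x = ∑ j, c j * ((physLevel ((j : ℕ) + 1) - luscherPotential x) * f j x) := by
  have h2 : ∀ j, ContDiff ℝ 2 (f j) := fun j => hf.1 j 2
  rw [eigSpanH0_apply, laplacian_def, eigSpan_eq]
  -- `Σ_p ∂_p∂_p F = Σ_j c_j Δ f_j`, `Δ f_j = 2 (V − E_j) f_j`
  have e1 : ∑ p, pderiv p (pderiv p (fun y => ∑ j, c j * f j y)) x = ∑ j, c j * laplacian (f j) x := by
    simp_rw [pderiv_pderiv_sum_mul h2 c _ _ x]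
    rw [Finset.sum_comm]
    refine Finset.sum_congr rfl fun j _ => ?_
    rw [laplacian_def, Finset.mul_sum]
  rw [e1, Finset.mul_sum]
  refine Finset.sum_congr rfl fun j _ => ?_
  rw [laplacian_eq_of_hApply_eq (hf.2.2.2.1 j) x]
  ring

/-- `H₀F` is continuous. [folklore] -/
theorem eigSpanH0_continuous (c : Fin (m + 1) → ℝ) : Continuous (eigSpanH0 f c) := by
  have hfc : ∀ j, Continuous (f j) := fun j => (hf.1 j 0).continuous
  have e : eigSpanH0 f c = fun x => ∑ j, c j * ((physLevel ((j : ℕ) + 1) - luscherPotential x) * f j x) := by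
    funext x; exact eigSpanH0_eq hf c x
  rw [e]
  exact continuous_finsetSum _ fun j _ => continuous_const.fun_mul
    ((continuous_const.fun_sub continuous_luscherPotential).fun_mul (hfc j))

/-- The building blocks `h_j = (E_j − V) f_j` are dominated by `(E + ¼‖x‖⁴) C e^{−‖x‖} ≤ C' e^{−‖x‖/…}`; concretely
`|h_j(x)|² ≤ …` is integrable: `∫ h_j² < ∞`. [folklore] -/
theorem integrable_sq_level_sub_potential_mul (j : Fin (m + 1)) :
    Integrable fun x => ((physLevel ((j : ℕ) + 1) - luscherPotential x) * f j x) ^ 2 := by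
  -- `h_j² ≤ 2 (E_j² f_j² + V² f_j²)` and `V² f_j² ≤ (¼)² ‖x‖⁸ C² e^{−2‖x‖} ≤ const · e^{−‖x‖}`
  obtain ⟨C, hC0, hC⟩ := (hf.2.2.2.2 j).exists_nonneg
  have hfc : Continuous (f j) := (hf.1 j 0).continuous
  have hcont : Continuous fun x => ((physLevel ((j : ℕ) + 1) - luscherPotential x) * f j x) ^ 2 :=
    ((continuous_const.fun_sub continuous_luscherPotential).fun_mul hfc).fun_pow 2
  set E := physLevel ((j : ℕ) + 1) with hE
  -- dominate by `(2 E² C² + 2·(1/16)·8!·C²) e^{−‖x‖}`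
  refine (integrable_exp_neg_norm.const_mul (2 * E ^ 2 * C ^ 2 + 2 * ((1 / 16 : ℝ) * 40320 * C ^ 2))).mono'
    hcont.aestronglyMeasurable (Eventually.of_forall fun x => ?_)
  rw [Real.norm_eq_abs, abs_of_nonneg (sq_nonneg _)]
  have hV0 := luscherPotential_nonneg x
  have hV := luscherPotential_le_norm_pow_four x
  have hfx : f j x ^ 2 ≤ (C * Real.exp (-‖x‖)) ^ 2 := by rw [← sq_abs]; exact pow_le_pow_left₀ (abs_nonneg _) (hC x).1 2
  have he : Real.exp (-‖x‖) ≤ 1 := Real.exp_le_one_iff.mpr (neg_nonpos.mpr (norm_nonneg x))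
  have he0 := Real.exp_pos (-‖x‖)
  -- `‖x‖⁸ e^{−‖x‖} ≤ 8!`
  have h8 : ‖x‖ ^ 8 * Real.exp (-‖x‖) ≤ 40320 := by
    have h := Real.pow_div_factorial_le_exp ‖x‖ (norm_nonneg x) 8
    have hf8 : (Nat.factorial 8 : ℝ) = 40320 := by norm_num [Nat.factorial]
    rw [hf8, div_le_iff₀ (by norm_num : (0:ℝ) < 40320)] at h
    rw [Real.exp_neg, mul_inv_le_iff₀ (Real.exp_pos _)]
    linarith
  have h1 : ((E - luscherPotential x) * f j x) ^ 2 ≤ 2 * (E ^ 2 + luscherPotential x ^ 2) * f j x ^ 2 := by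
    nlinarith [sq_nonneg (E + luscherPotential x), sq_nonneg (f j x), mul_nonneg (sq_nonneg (E + luscherPotential x)) (sq_nonneg (f j x))]
  have h2' : luscherPotential x ^ 2 ≤ (1 / 16 : ℝ) * ‖x‖ ^ 8 := by nlinarith [pow_nonneg (norm_nonneg x) 4]
  have hn := norm_nonneg x
  calc ((E - luscherPotential x) * f j x) ^ 2 ≤ 2 * (E ^ 2 + luscherPotential x ^ 2) * (C * Real.exp (-‖x‖)) ^ 2 := by
        refine h1.trans (mul_le_mul_of_nonneg_left hfx (by positivity))
    _ ≤ 2 * (E ^ 2 + (1 / 16 : ℝ) * ‖x‖ ^ 8) * (C * Real.exp (-‖x‖)) ^ 2 := by gcongr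
    _ = 2 * E ^ 2 * C ^ 2 * (Real.exp (-‖x‖) * Real.exp (-‖x‖)) +
          2 * ((1 / 16 : ℝ) * (‖x‖ ^ 8 * Real.exp (-‖x‖)) * C ^ 2) * Real.exp (-‖x‖) := by ring
    _ ≤ 2 * E ^ 2 * C ^ 2 * (1 * Real.exp (-‖x‖)) + 2 * ((1 / 16 : ℝ) * 40320 * C ^ 2) * Real.exp (-‖x‖) := by
        gcongr
    _ = (2 * E ^ 2 * C ^ 2 + 2 * ((1 / 16 : ℝ) * 40320 * C ^ 2)) * Real.exp (-‖x‖) := by ring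

/-- **`H₀F ∈ L²` with `∫ (H₀F)² ≤ K Σ c_j²`**, `K = Σ_j ∫ ((E_j − V) f_j)²` (Cauchy–Schwarz in `j`). [folklore] -/
theorem integral_eigSpanH0_sq_le (c : Fin (m + 1) → ℝ) :
    Integrable (fun x => eigSpanH0 f c x ^ 2) ∧
      ∫ x, eigSpanH0 f c x ^ 2 ≤ (∑ j : Fin (m + 1), ∫ x, ((physLevel ((j : ℕ) + 1) - luscherPotential x) * f j x) ^ 2) * ∑ j, c j ^ 2 := by
  set h : Fin (m + 1) → ZM → ℝ := fun j x => (physLevel ((j : ℕ) + 1) - luscherPotential x) * f j x with hh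
  have hI : ∀ j, Integrable fun x => h j x ^ 2 := fun j => integrable_sq_level_sub_potential_mul hf j
  have hpt : ∀ x, eigSpanH0 f c x ^ 2 ≤ (∑ j, c j ^ 2) * ∑ j, h j x ^ 2 := fun x => by
    rw [eigSpanH0_eq hf c x]
    exact Finset.sum_mul_sq_le_sq_mul_sq Finset.univ c (fun j => h j x)
  have hdom : Integrable fun x => (∑ j, c j ^ 2) * ∑ j, h j x ^ 2 := (integrable_finsetSum _ fun j _ => hI j).const_mul _
  have hcont := eigSpanH0_continuous hf c
  have hint : Integrable fun x => eigSpanH0 f c x ^ 2 :=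
    hdom.mono' (hcont.fun_pow 2).aestronglyMeasurable (Eventually.of_forall fun x => by
      rw [Real.norm_eq_abs, abs_of_nonneg (sq_nonneg _)]; exact hpt x)
  refine ⟨hint, ?_⟩
  calc ∫ x, eigSpanH0 f c x ^ 2 ≤ ∫ x, (∑ j, c j ^ 2) * ∑ j, h j x ^ 2 := integral_mono hint hdom hpt
    _ = (∑ j, c j ^ 2) * ∑ j, ∫ x, h j x ^ 2 := by rw [integral_const_mul, integral_finsetSum _ fun j _ => hI j]
    _ = (∑ j : Fin (m + 1), ∫ x, ((physLevel ((j : ℕ) + 1) - luscherPotential x) * f j x) ^ 2) * ∑ j, c j ^ 2 := by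
        rw [mul_comm]

/-- `H₀F ∈ L¹` (bounded by a continuous `L²`… concretely: `|H₀F| ≤ Σ|c_j| (E_j + V)|f_j| ≤ A e^{−‖x‖/…}`); we record integrability. [folklore] -/
theorem eigSpanH0_integrable (c : Fin (m + 1) → ℝ) : Integrable (eigSpanH0 f c) := by
  -- `H₀F = -(1/2) Σ_p ∂_p∂_p F`, each summand integrable
  obtain ⟨-, -, hI2, -⟩ := eigSpan_integrable hf c
  have e : eigSpanH0 f c = fun x => -(1 / 2 : ℝ) * ∑ p, pderiv p (pderiv p (eigSpan f c)) x := by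
    funext x; rw [eigSpanH0_apply, laplacian_def]
  rw [e]
  exact (integrable_finsetSum _ fun p _ => hI2 p p).const_mul _

end Span

end Summit.QuantumFields.YangMills.Theorems.FemtoTransferGap

end
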